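import Summits.Schanuel.Schanuel.Theorems.RootDecomp1BTranscendencePackageFloor03

/-!
# `RootDecomp1BTranscendencePackageFloor` — part 04 of 05 (`RootDecomp1BTranscendencePackageFloor04`): §5 transcendence-degree toolkit (private copies); §6 the storey-0 PLANT `ℓ₀ = log 2`, `u₀ = 2 cos ℓ₀`, `w₀ = 2^i`, the functional `φ₀`, the shear `S₀`, the model `E₀` (`E₀ u₀ = 2`, `E₀ (iu₀) = 2^i`, `not_continuous_E₀`), the field `K₀ = ℚ(2^i)` of transcendence degree `≤ 1` and the algebraicity of the polar pair over it

See part 01 (`Summits.Schanuel.Schanuel.Theorems.RootDecomp1BTranscendencePackageFloor01`) for the overview of the port (decomp-schanuel lens-4, gens 16–17; `--supports stmt-Schanuel-24622`; sorry-free, standard axioms; nothing here proves Schanuel — rung 0).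
-/

noncomputable section

open Complex

set_option linter.dupNamespace false

namespace Summit.Schanuel.Schanuel.Theorems.RootDecomp1BTranscendencePackageFloor

/-! ## §5 Transcendence-degree toolkit (private copies of tree folklore)

Private copies of `Literature.NumberTheory.Transcendental.PrasadRapinchuk.trdeg_adjoin_le_of_isAlgebraic` and
`Literature.Barriers.Schanuel.trdeg_adjoin_singleton_le_one` (same statements and proofs), private so that nothing is
restated publicly; their home modules are not imported to keep the import cone of this port small. -/

open IntermediateField in
/-- If every element of `T` is algebraic over `K ≤ ℂ` then `trdeg_ℚ ℚ(T) ≤ trdeg_ℚ K`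
(`ℚ(T) ⊆ K(T)`, algebraic over `K`; private copy of
`Literature.NumberTheory.Transcendental.PrasadRapinchuk.trdeg_adjoin_le_of_isAlgebraic`).
[folklore] -/
private theorem trdeg_adjoin_le_of_isAlgebraic (K : IntermediateField ℚ ℂ) {T : Set ℂ}
    (hT : ∀ x ∈ T, IsAlgebraic K x) :
    Algebra.trdeg ℚ (adjoin ℚ T) ≤ Algebra.trdeg ℚ K := by
  have hmono : Algebra.trdeg ℚ (adjoin ℚ T) ≤ Algebra.trdeg ℚ (adjoin ℚ ((K : Set ℂ) ∪ T)) :=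
    trdeg_le_of_injective
      (IntermediateField.inclusion (adjoin.mono ℚ _ _ Set.subset_union_right))
      (IntermediateField.inclusion_injective _)
  refine hmono.trans ?_
  haveI : Algebra.IsAlgebraic K (adjoin K T) :=
    isAlgebraic_adjoin fun x hx => (hT x hx).isIntegral
  have h := trdeg_add_eq ℚ K (A := adjoin K T)
  rw [trdeg_eq_zero (R := K) (A := adjoin K T), add_zero] at h
  have e := (equivOfEq (restrictScalars_adjoin ℚ K T)).symm.trdeg_eq
  calc Algebra.trdeg ℚ (adjoin ℚ ((K : Set ℂ) ∪ T))
      = Algebra.trdeg ℚ ((adjoin K T).restrictScalars ℚ) := e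
    _ = Algebra.trdeg ℚ (adjoin K T) := rfl
    _ = Algebra.trdeg ℚ K := h.symm
    _ ≤ Algebra.trdeg ℚ K := le_rfl

open scoped IntermediateField.algebraAdjoinAdjoin in
/-- `trdeg_ℚ ℚ(t) ≤ 1` (a transcendence basis of `ℚ(t)` may be chosen inside `{t}`; private copy,
at `K = ℚ`, `E = ℂ`, of `Literature.Barriers.Schanuel.trdeg_adjoin_singleton_le_one`). [folklore] -/
private theorem trdeg_adjoin_singleton_le_one (t : ℂ) :
    Algebra.trdeg ℚ ↥(IntermediateField.adjoin ℚ ({t} : Set ℂ)) ≤ 1 := by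
  classical
  let Lt : IntermediateField ℚ ℂ := IntermediateField.adjoin ℚ ({t} : Set ℂ)
  let t' : Lt := ⟨t, IntermediateField.mem_adjoin_simple_self ℚ t⟩
  have hmap : Subalgebra.map Lt.val (Algebra.adjoin ℚ ({t'} : Set Lt)) =
      Algebra.adjoin ℚ ({t} : Set ℂ) := by
    rw [AlgHom.map_adjoin, Set.image_singleton]
    rfl
  let e : Algebra.adjoin ℚ ({t'} : Set Lt) ≃ₐ[ℚ] Algebra.adjoin ℚ ({t} : Set ℂ) :=
    (Subalgebra.equivMapOfInjective _ Lt.val Subtype.val_injective).trans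
      (Subalgebra.equivOfEq _ _ hmap)
  haveI : Algebra.IsAlgebraic (Algebra.adjoin ℚ ({t'} : Set Lt)) Lt := by
    refine ⟨fun y => ?_⟩
    have hy : IsAlgebraic (Algebra.adjoin ℚ ({t} : Set ℂ)) (y : Lt) :=
      Algebra.IsAlgebraic.isAlgebraic y
    refine IsAlgebraic.of_ringHom_of_comp_eq (e : _ →+* _) (RingHom.id Lt) (by simpa using hy)
      e.surjective Function.injective_id ?_
    ext x
    rfl
  have h := Algebra.IsAlgebraic.trdeg_le_cardinalMk (R := ℚ) ({t'} : Set Lt)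
  simpa using h

/-- An element of an intermediate field `K` is algebraic over `K`. [folklore] -/
private theorem isAlgebraic_of_mem {K : IntermediateField ℚ ℂ} {x : ℂ} (hx : x ∈ K) : IsAlgebraic K x :=
  isAlgebraic_algebraMap (⟨x, hx⟩ : K)

/-! ## §6 The storey-0 plant: `u₀ = 2 cos (log 2)`, `ℓ₀ = log 2`, `w₀ = 2^i` -/

/-- `ℓ₀ = log 2`. [folklore] -/
def ℓ₀ : ℝ := Real.log 2

/-- `u₀ = 2 cos (log 2) = 2^i + 2^{-i}`. [folklore] -/
def u₀ : ℝ := 2 * Real.cos ℓ₀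

/-- `w₀ = 2^i = e^{i log 2}`. [folklore] -/
def w₀ : ℂ := cexp ((ℓ₀ : ℂ) * I)

/-- `e^{ℓ₀} = 2`. [folklore] -/
theorem exp_ℓ₀ : cexp (ℓ₀ : ℂ) = 2 := by
  rw [← Complex.ofReal_exp, ℓ₀, Real.exp_log two_pos]; norm_num

/-- `ℓ₀ > 0`. [folklore] -/
theorem ℓ₀_pos : 0 < ℓ₀ := Real.log_pos one_lt_two

/-- `ℓ₀ < 0.7` (Mathlib's `Real.log_two_lt_d9`). [folklore] -/
theorem ℓ₀_lt : ℓ₀ < 0.7 := lt_trans Real.log_two_lt_d9 (by norm_num)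

/-- `ℓ₀ ≠ 0` in `ℂ`. [folklore] -/
theorem ℓ₀C_ne_zero : (ℓ₀ : ℂ) ≠ 0 := by exact_mod_cast ℓ₀_pos.ne'

/-- `w₀ ≠ 0`. [folklore] -/
theorem w₀_ne_zero : w₀ ≠ 0 := Complex.exp_ne_zero _

/-- `u₀ = w₀ + w₀⁻¹` (`2 cos t = e^{it} + e^{−it}`). [folklore] -/
theorem u₀_eq : (u₀ : ℂ) = w₀ + w₀⁻¹ := by
  rw [u₀]; push_cast
  rw [Complex.two_cos, w₀, ← Complex.exp_neg, neg_mul]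

/-- `u₀ > 0` (`0 < ℓ₀ < π/2`). [folklore] -/
theorem u₀_pos : 0 < u₀ := by
  have hpi := Real.pi_gt_three
  have h : 0 < Real.cos ℓ₀ := Real.cos_pos_of_mem_Ioo ⟨by linarith [ℓ₀_pos], by linarith [ℓ₀_lt]⟩
  unfold u₀; positivity

/-- `u₀ ≠ 0`. [folklore] -/
theorem u₀_ne_zero : u₀ ≠ 0 := u₀_pos.ne'

/-- `u₀ > 1.51` (from `cos x ≥ 1 - x²/2`). [folklore] -/
theorem u₀_gt : 1.51 < u₀ := by
  have h := Real.one_sub_sq_div_two_le_cos (x := ℓ₀)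
  have h1 := ℓ₀_lt
  have h2 := ℓ₀_pos
  unfold u₀; nlinarith

/-- `2` is algebraic. [folklore] -/
private theorem two_isAlgebraic : IsAlgebraic ℚ (2 : ℂ) := by
  have h : IsAlgebraic ℚ ((2 : ℕ) : ℂ) := isAlgebraic_nat 2
  simpa using h

/-- `i` is algebraic. [folklore] -/
private theorem I_isAlgebraic : IsAlgebraic ℚ I := mem_Qb_iff.mp I_mem_Qb

/-- `i ∉ ℚ`. [folklore] -/
theorem I_not_mem_range : I ∉ Set.range ((↑) : ℚ → ℂ) := by
  rintro ⟨q, hq⟩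
  have := congrArg Complex.im hq
  simp at this

open Literature.NumberTheory.Transcendental in
/-- `w₀ = 2^i` is transcendental (Gelfond–Schneider with `β = i`). [cite: Gelfond1934] -/
theorem transcendental_w₀ : Transcendental ℚ w₀ := by
  have h := gelfond_schneider_holds (a := 2) (b := I) (l := ℓ₀) two_isAlgebraic I_isAlgebraic
    I_not_mem_range exp_ℓ₀ ℓ₀C_ne_zero
  rw [w₀, mul_comm]; exact h

open Literature.NumberTheory.Transcendental in
/-- `ℓ₀ = log 2` is transcendental (Hermite–Lindemann). [cite: Lindemann1882] -/
theorem transcendental_ℓ₀ : Transcendental ℚ (ℓ₀ : ℂ) := by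
  intro halg
  have h := transcendental_exp_holds halg ℓ₀C_ne_zero
  rw [exp_ℓ₀] at h
  exact h two_isAlgebraic

/-- `u₀` is transcendental (else `w₀`, a root of `X² - u₀ X + 1`, would be algebraic). [folklore] -/
theorem transcendental_u₀ : Transcendental ℚ (u₀ : ℂ) := by
  intro halg
  set K : IntermediateField ℚ ℂ := IntermediateField.adjoin ℚ {(u₀ : ℂ)} with hK
  haveI : FiniteDimensional ℚ K := IntermediateField.adjoin.finiteDimensional halg.isIntegral
  haveI : Algebra.IsIntegral ℚ K := Algebra.IsIntegral.of_finite ℚ K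
  have hu : (u₀ : ℂ) ∈ K := IntermediateField.mem_adjoin_simple_self ℚ _
  set u' : K := ⟨u₀, hu⟩ with hu'
  -- `w₀` is a root of `X² - u₀ X + 1 ∈ K[X]`
  have hw : IsAlgebraic K w₀ := by
    refine ⟨Polynomial.X ^ 2 - Polynomial.C u' * Polynomial.X + 1, ?_, ?_⟩
    · intro h
      have := congrArg (fun p : Polynomial K => p.coeff 2) h
      simp [Polynomial.coeff_one] at this
    · have h1 : (Polynomial.aeval w₀) (Polynomial.X ^ 2 - Polynomial.C u' * Polynomial.X + 1 :
          Polynomial K) = w₀ ^ 2 - (u₀ : ℂ) * w₀ + 1 := by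
        simp [hu']
      rw [h1, u₀_eq]
      field_simp [w₀_ne_zero]
      ring
  have hint : IsIntegral ℚ w₀ := isIntegral_trans w₀ hw.isIntegral
  exact transcendental_w₀ hint.isAlgebraic

/-- `u₀` is transcendental as a real number. [folklore] -/
theorem transcendental_u₀_real : Transcendental ℚ u₀ := by
  intro h
  have h1 : (u₀ : ℂ) ∈ Qb := mem_A_iff_coe_mem_Qb.mp (mem_A_iff.mpr h)
  exact transcendental_u₀ (mem_Qb_iff.mp h1)

/-- `ℓ₀` is transcendental as a real number. [folklore] -/
theorem transcendental_ℓ₀_real : Transcendental ℚ ℓ₀ := by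
  intro h
  have h1 : (ℓ₀ : ℂ) ∈ Qb := mem_A_iff_coe_mem_Qb.mp (mem_A_iff.mpr h)
  exact transcendental_ℓ₀ (mem_Qb_iff.mp h1)

/-- `u₀ ∉ A`. [folklore] -/
theorem u₀_not_mem_A : u₀ ∉ A := fun h => transcendental_u₀_real (mem_A_iff.mp h)

/-- `ℓ₀ ∉ A`. [folklore] -/
theorem ℓ₀_not_mem_A : ℓ₀ ∉ A := fun h => transcendental_ℓ₀_real (mem_A_iff.mp h)

/-- `1, u₀` are `A`-linearly independent. [folklore] -/
theorem linearIndependent_one_u₀ : LinearIndependent A ![(1 : ℝ), u₀] := by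
  rw [LinearIndependent.pair_iff]
  intro s t h
  have h' : (s : ℝ) + (t : ℝ) * u₀ = 0 := by
    have := h
    simp only [Algebra.smul_def, mul_one] at this
    exact this
  by_cases ht : t = 0
  · subst ht
    simp at h'
    exact ⟨by exact_mod_cast h', rfl⟩
  · exfalso
    apply u₀_not_mem_A
    have ht' : (t : ℝ) ≠ 0 := by exact_mod_cast ht
    have hu : u₀ = -(s : ℝ) / (t : ℝ) := by
      field_simp
      linarith
    rw [hu]
    exact div_mem (neg_mem s.2) t.2

/-- Functionals with prescribed values on an `A`-free family. [linear algebra] [folklore] -/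
theorem exists_functional {ι : Type*} {v : ι → ℝ} (hv : LinearIndependent A v) (c : ι → A) :
    ∃ φ : ℝ →ₗ[A] A, ∀ i, φ (v i) = c i := by
  classical
  obtain ⟨g, hg⟩ := LinearMap.exists_extend ((Finsupp.linearCombination A c).comp hv.repr)
  refine ⟨g, fun i => ?_⟩
  have hmem : v i ∈ Submodule.span A (Set.range v) := Submodule.subset_span ⟨i, rfl⟩
  have h1 := LinearMap.congr_fun hg ⟨v i, hmem⟩
  simp only [LinearMap.coe_comp, Function.comp_apply, Submodule.coe_subtype] at h1
  rw [h1, hv.repr_eq_single i ⟨v i, hmem⟩ rfl, Finsupp.linearCombination_single, one_smul]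

/-- The shear functional: `φ 1 = 0`, `φ u₀ = 1`, `φ ℓ₀ ≠ 0`. [folklore] -/
theorem exists_phi : ∃ φ : ℝ →ₗ[A] A, φ 1 = 0 ∧ φ u₀ = 1 ∧ φ ℓ₀ ≠ 0 := by
  by_cases hmem : ℓ₀ ∈ Submodule.span A (Set.range ![(1 : ℝ), u₀])
  · obtain ⟨φ, hφ⟩ := exists_functional linearIndependent_one_u₀ ![0, 1]
    have h0 : φ 1 = 0 := by simpa using hφ 0
    have h1 : φ u₀ = 1 := by simpa using hφ 1
    refine ⟨φ, h0, h1, ?_⟩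
    rw [Submodule.mem_span_range_iff_exists_fun] at hmem
    obtain ⟨cf, hcf⟩ := hmem
    rw [Fin.sum_univ_two] at hcf
    simp only [Matrix.cons_val_zero, Matrix.cons_val_one] at hcf
    have hφℓ : φ ℓ₀ = cf 1 := by
      rw [← hcf, map_add, map_smul, map_smul, h0, h1, smul_zero, zero_add, smul_eq_mul, mul_one]
    intro hzero
    rw [hφℓ] at hzero
    apply ℓ₀_not_mem_A
    rw [← hcf, hzero, zero_smul, add_zero, Algebra.smul_def, mul_one]
    exact (cf 0).2
  · have hli : LinearIndependent A ![ℓ₀, (1 : ℝ), u₀] := by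
      show LinearIndependent A (Fin.cons ℓ₀ ![(1 : ℝ), u₀])
      exact linearIndependent_finCons.mpr ⟨linearIndependent_one_u₀, hmem⟩
    obtain ⟨φ, hφ⟩ := exists_functional hli ![1, 0, 1]
    refine ⟨φ, by simpa using hφ 1, by simpa using hφ 2, ?_⟩
    have : φ ℓ₀ = 1 := by simpa using hφ 0
    rw [this]; exact one_ne_zero

/-- The chosen functional and the storey-0 shear. [folklore] -/
def φ₀ : ℝ →ₗ[A] A := Classical.choose exists_phi

/-- `φ₀ 1 = 0`, `φ₀ u₀ = 1`, `φ₀ ℓ₀ ≠ 0`. [folklore] -/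
theorem φ₀_spec : φ₀ 1 = 0 ∧ φ₀ u₀ = 1 ∧ φ₀ ℓ₀ ≠ 0 := Classical.choose_spec exists_phi

/-- The storey-0 involutive shear `(φ₀, u₀, ℓ₀)`. [folklore] -/
def S₀ : Shear := ⟨φ₀, u₀, ℓ₀, φ₀_spec.1, φ₀_spec.2.1, φ₀_spec.2.2⟩

/-- THE MODEL: `E₀ = exp ∘ θ₀`. [folklore] -/
def E₀ : ℂ → ℂ := S₀.E

/-- `E₀` is the sheared exponential of `S₀`. [folklore] -/
theorem E₀_def : E₀ = S₀.E := rfl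

/-- **`E₀ u₀ = 2`** (`θ₀ u₀ = ℓ₀ = log 2`). [folklore] -/
theorem E₀_u₀ : E₀ u₀ = 2 := by
  rw [E₀, Shear.E_apply, show (u₀ : ℂ) = (S₀.u : ℂ) from rfl, S₀.θ_u]; exact exp_ℓ₀

/-- **`E₀ (iu₀) = 2^i`** (`θ₀ (iu₀) = i log 2`). [folklore] -/
theorem E₀_u₀_mul_I : E₀ ((u₀ : ℂ) * I) = w₀ := by
  rw [E₀, Shear.E_apply, show (u₀ : ℂ) = (S₀.u : ℂ) from rfl, S₀.θ_u_mul_I]; rfl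

/-- `E₀` is genuinely not `exp`, already on the real axis: `E₀ u₀ = 2 < e^{1.51} < e^{u₀}`.
[folklore] -/
theorem E₀_u₀_ne_exp : E₀ u₀ ≠ cexp u₀ := by
  rw [E₀_u₀, ← Complex.ofReal_exp]
  intro h
  have h1 : (2 : ℝ) = Real.exp u₀ := by exact_mod_cast h
  have h2 := Real.add_one_le_exp u₀
  have h3 := u₀_gt
  linarith

/-- The shear `S₀` is non-trivial: `d₀ = ℓ₀ − u₀ < 0.7 − 1.51 < 0`. [folklore] -/
theorem S₀_d_ne_zero : S₀.d ≠ 0 := by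
  have h1 : S₀.d = ℓ₀ - u₀ := rfl
  have h2 := ℓ₀_lt
  have h3 := u₀_gt
  rw [h1]
  intro h
  linarith

/-- **`E₀` restricted to `ℝ` is discontinuous** — the order / continuity channel at transcendental
arguments is exactly what the transcendence package below does not record. [folklore] -/
theorem not_continuous_E₀_real : ¬ Continuous fun x : ℝ => E₀ x :=
  S₀.not_continuous_E_ofReal S₀_d_ne_zero

/-- **`E₀` is discontinuous.** [folklore] -/
theorem not_continuous_E₀ : ¬ Continuous E₀ := S₀.not_continuous_E S₀_d_ne_zero

/-- The base field of the plant: `K₀ = ℚ(w₀)`, `trdeg ≤ 1`. [folklore] -/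
def K₀ : IntermediateField ℚ ℂ := IntermediateField.adjoin ℚ {w₀}

/-- `trdeg_ℚ K₀ ≤ 1` (one generator). [folklore] -/
theorem trdeg_K₀_le_one : Algebra.trdeg ℚ K₀ ≤ 1 := trdeg_adjoin_singleton_le_one w₀

/-- `w₀ ∈ K₀`. [folklore] -/
theorem w₀_mem_K₀ : w₀ ∈ K₀ := IntermediateField.mem_adjoin_simple_self ℚ _

/-- `u₀ = w₀ + w₀⁻¹ ∈ K₀`. [folklore] -/
theorem u₀_mem_K₀ : (u₀ : ℂ) ∈ K₀ := by
  rw [u₀_eq]; exact add_mem w₀_mem_K₀ (inv_mem w₀_mem_K₀)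

/-- `u₀` is algebraic over `K₀`. [folklore] -/
theorem alg_u₀ : IsAlgebraic K₀ (u₀ : ℂ) := isAlgebraic_of_mem u₀_mem_K₀

/-- `i` is algebraic over `K₀`. [folklore] -/
theorem alg_I : IsAlgebraic K₀ I := I_isAlgebraic.tower_top (L := K₀)

/-- `iu₀` is algebraic over `K₀`. [folklore] -/
theorem alg_u₀I : IsAlgebraic K₀ ((u₀ : ℂ) * I) := alg_u₀.mul alg_I

/-- `E₀ u₀ = 2` is algebraic over `K₀`. [folklore] -/
theorem alg_E₀u₀ : IsAlgebraic K₀ (E₀ u₀) := by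
  rw [E₀_u₀]; exact isAlgebraic_of_mem (by simp)

/-- `E₀ (iu₀) = w₀` is algebraic over `K₀`. [folklore] -/
theorem alg_E₀u₀I : IsAlgebraic K₀ (E₀ ((u₀ : ℂ) * I)) := by
  rw [E₀_u₀_mul_I]; exact isAlgebraic_of_mem w₀_mem_K₀

/-- Any field generated by elements algebraic over `K₀` has `trdeg ≤ 1`. [folklore] -/
theorem trdeg_le_one_of_forall {T : Set ℂ} (hT : ∀ x ∈ T, IsAlgebraic K₀ x) :
    Algebra.trdeg ℚ (IntermediateField.adjoin ℚ T) ≤ 1 :=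
  (trdeg_adjoin_le_of_isAlgebraic K₀ hT).trans trdeg_K₀_le_one

/-- The length-one real family `(u₀)` is `ℚ`-free. [folklore] -/
theorem linearIndependent_u₀ : LinearIndependent ℚ ![u₀] :=
  linearIndependent_unique_iff.mpr (by simpa using u₀_ne_zero)

/-- The polar pair `(u₀, iu₀)` is `ℚ`-free. [folklore] -/
theorem linearIndependent_u₀_u₀I : LinearIndependent ℚ ![(u₀ : ℂ), (u₀ : ℂ) * I] := by
  rw [LinearIndependent.pair_iff]
  intro s t h
  rw [Rat.smul_def, Rat.smul_def] at h
  have hre := congrArg Complex.re h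
  have him := congrArg Complex.im h
  simp at hre him
  rcases hre with hre | hre
  · rcases him with him | him
    · exact ⟨hre, him⟩
    · exact absurd him u₀_ne_zero
  · exact absurd hre u₀_ne_zero

end Summit.Schanuel.Schanuel.Theorems.RootDecomp1BTranscendencePackageFloor

end
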